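import Summits.AtomisticToContinuum.HydrodynamicLimit.Theorems.ImplosionDichotomyHydroLimitInBandWindowContinuityFields
import Summits.AtomisticToContinuum.HydrodynamicLimit.Theorems.ImplosionDichotomyHydroLimitInBandWindowContinuityTransfer
import Summits.AtomisticToContinuum.HydrodynamicLimit.Theorems.ImplosionDichotomyHydroLimitInBandWindowContinuityKinematics
import HarnessLib

/-!
# Window continuity of the relative-entropy ledger, in band — the one-window estimate
(helper of stub `stub_windowContinuityInBand`, line `IdeatorOneSketch`, crux `HydroLimitInBand`,
stmt-AtomisticToContinuum-9133)

Support file (`--supports stmt-AtomisticToContinuum-9133`). The deterministic heart of the crude short-time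
continuity of Yau's clock `H_N(s) = KL(lawAt Φ λ_N s ‖ ψ_s)` along the explicit reference family
`ψ_s = localGibbsLaw σ (ρ_s Rf(σ³ρ_s)) (u s) (θ s)`: for ONE `N`, one flow and one window `[s, s'] ⊆ [0, t]`,
`|H_N(s') − H_N(s)| ≤ (s' − s) A₁ + ε_N (κ₁⁻¹ A₂ + κ₂⁻¹ A₃)` with constants explicit in the slab data of the Euler
solution, a second-moment bound, a cubic-tail bound (`EnergyCurrentTails` at one level) and momentum / energy
window-activity tail bounds (`CollisionActivityTails` and its energy twin at one level) — `abs_klDiv_window_sub_le`.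
Ingredients: the explicit entropies `EntropyClockDock.toReal_klDiv_lawAt_eq_integral`; the one-body exponent splits as
`Σ_i log b_s(x_i) + (unit-activity exponent)`; the sibling dock's pathwise balance
`ClampedCurrentsDockPathwise.gSum_sub_eq` for the unit-activity exponent (streaming integral + pair-kernel
collision sum), priced by `…WindowContinuityStreaming` and `…WindowContinuityTransfer`; the activity part
`Σ_i [log b_s(x_i(s)) − log b_{s'}(x_i(s'))]` by the joint Lipschitz bound of `log b` (density slab bounds,
`Rf ∈ [1, 2]` Lipschitz on the packing range) and the mean displacement bound along a good orbit
(`sum_euclidDist_flow_le` of `…WindowContinuityKinematics`, conserved energy); the log-partition increment by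
`abs_log_posPartition_sub_le`.

References: H.-T. Yau, Lett. Math. Phys. 22 (1991) §2; S. Olla, S. R. S. Varadhan, H.-T. Yau, Comm. Math.
Phys. 155 (1993) §3.
-/

noncomputable section

open MeasureTheory Filter Set Topology InformationTheory
open scoped ENNReal

namespace Summit.AtomisticToContinuum.HydrodynamicLimit.Theorems.HydroLimitInBandContinuity

open Literature.MathematicalPhysics.KineticTheory Literature.Analysis.FluidPDE
open Literature.Analysis.FunctionSpaces
open Summit.AtomisticToContinuum.HydrodynamicLimit.Theorems.ClampedCurrentsDockPathwise
  (gExp DgExp gSum DgSum pairKernel gSum_sub_eq)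
open Summit.AtomisticToContinuum.HydrodynamicLimit.Theorems.EntropyClockDock
  (ae_mem_good_localGibbsLaw toReal_klDiv_lawAt_eq_integral integrable_oneBodySum integrable_oneBodySum_flow)

variable {σ : ℝ} {N : ℕ} {a₀ θ₀ : T3 → ℝ} {u₀ : T3 → V3}

/-! ### The one-window estimate -/

/-- **THE ONE-WINDOW ESTIMATE of the crude continuity of `H_N`.** For `0 < σ < 1/2`, continuous positive initial
profiles, a classical hard-sphere Euler solution on `[0, T)`, `t ∈ (0, T)` with packing `ρ σ³ < r` on `[0, t]`,
an insertion factor `1 ≤ Rf ≤ 2`, `LR`-Lipschitz on `[0, r]`, one `N`, one flow `Φ`, and constants: `K` (cubic bound on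
the streaming rate of the unit-activity exponent on `[0, t]`), `L` (spatial Lipschitz constant of `u_j/θ`, `θ⁻¹`),
`Kρ` (joint Lipschitz constant of `ρ`), `m` (lower bound of `ρ`), `C` (`E[(N+1)⁻¹ Σ|v_i|²] ≤ C`), `M` (cubic tails
`≤ 1` at level `M` on `[0, t]`), and momentum / energy window-activity tail bounds `≤ 1` at levels `V₁, V₂`, rates
`κ₁, κ₂ > 0` and window lengths `w₁, w₂`: for `s ≤ s'` in `[0, t]` with `s' ≤ s + w₁`, `s' ≤ s + w₂`,
`|H_N(s') − H_N(s)| ≤ (s' − s)(N+1)[K(2 + M₊C) + C_b (3 + C)/2 + C_b] + 4 L ε_N (N+1)[κ₁⁻¹(V₁+1) + κ₂⁻¹(V₂+1)]`,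
`C_b = (m⁻¹ + LR σ³) Kρ`, `H_N(s) = KL(lawAt Φ λ_N s ‖ localGibbsLaw σ (ρ_s Rf(σ³ρ_s)) (u s) (θ s))`. [cite: Yau1991, §2] -/
theorem abs_klDiv_window_sub_le (hσ : 0 < σ) (hσhalf : σ < 1 / 2) (ha : Continuous a₀) (hθi : Continuous θ₀)
    (hui : Continuous u₀) (ha0 : ∀ x, 0 < a₀ x) (hθi0 : ∀ x, 0 < θ₀ x)
    {T : ℝ} {ρ θ : ℝ → T3 → ℝ} {u : ℝ → T3 → V3} (hE : IsHardSphereEulerSolution σ T ρ u θ)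
    {t : ℝ} (ht : t ∈ Ioo 0 T) {r : ℝ} {Rf : ℝ → ℝ} (hRf : ∀ x ∈ Icc 0 r, 1 ≤ Rf x ∧ Rf x ≤ 2) {LR : NNReal}
    (hLR : LipschitzOnWith LR Rf (Icc 0 r)) (hpack : ∀ s ∈ Icc 0 t, ∀ x, ρ s x * σ ^ 3 < r)
    (N : ℕ) (Φ : HardSphereFlow (Torus.geometry (Fin 3)) (hsDiameter σ N) (N + 1))
    {K : ℝ} (hK0 : 0 ≤ K)
    (hK : ∀ r' ∈ Icc 0 t, ∀ y : T3 × V3, |DgExp T (fun _ _ => (1 : ℝ)) θ u r' y| ≤ K * (1 + ‖y.2‖ ^ 3))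
    {L : ℝ} (hL0 : 0 ≤ L)
    (hβ : ∀ r' ∈ Icc 0 t, ∀ (x x' : T3) (j : Fin 3),
      |u r' x j / θ r' x - u r' x' j / θ r' x'| ≤ L * Torus.euclidDist x x')
    (hγ : ∀ r' ∈ Icc 0 t, ∀ x x' : T3, |(θ r' x)⁻¹ - (θ r' x')⁻¹| ≤ L * Torus.euclidDist x x')
    {Kρ : ℝ} (hKρ0 : 0 ≤ Kρ) (hKρ : ∀ s₁ ∈ Icc 0 t, ∀ s₂ ∈ Icc 0 t, ∀ x x' : T3,
      ‖ρ s₁ x - ρ s₂ x'‖ ≤ Kρ * (|s₁ - s₂| + Torus.euclidDist x x'))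
    {m : ℝ} (hm0 : 0 < m) (hm : ∀ s₁ ∈ Icc 0 t, ∀ x, m ≤ ρ s₁ x)
    {C : ℝ} (hC0 : 0 ≤ C)
    (hKE : ∫⁻ z, ENNReal.ofReal (((N : ℝ) + 1)⁻¹ * ∑ i, ‖(z i).2‖ ^ 2) ∂(localGibbsLaw σ a₀ u₀ θ₀ N Φ) ≤
      ENNReal.ofReal C)
    {M : ℝ} (hECT : ∀ r' ∈ Icc 0 t, ∫⁻ z, ENNReal.ofReal (((N : ℝ) + 1)⁻¹ * ∑ i : Fin (N + 1),
      Set.indicator {v : V3 | M < ‖v‖} (fun v => ‖v‖ ^ 3) ((Φ.flow r' z i).2)) ∂(localGibbsLaw σ a₀ u₀ θ₀ N Φ) ≤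
      ENNReal.ofReal 1)
    {V₁ κ₁ w₁ : ℝ} (hV₁ : 0 ≤ V₁) (hκ₁ : 0 < κ₁)
    (hCATb : ∀ s₁ ∈ Icc 0 t, ∫⁻ z, ENNReal.ofReal (((N : ℝ) + 1)⁻¹ * ∑ i : Fin (N + 1),
      Set.indicator {y : ℝ | V₁ < y} (fun y => y) (κ₁ * Φ.collisionSum (Ioc s₁ (s₁ + w₁))
        (fun c => if c.fst = i then ‖c.postVel.1 - c.preVel.1‖ else 0) z)) ∂(localGibbsLaw σ a₀ u₀ θ₀ N Φ) ≤
      ENNReal.ofReal 1)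
    {V₂ κ₂ w₂ : ℝ} (hV₂ : 0 ≤ V₂) (hκ₂ : 0 < κ₂)
    (hCEATb : ∀ s₁ ∈ Icc 0 t, ∫⁻ z, ENNReal.ofReal (((N : ℝ) + 1)⁻¹ * ∑ i : Fin (N + 1),
      Set.indicator {y : ℝ | V₂ < y} (fun y => y) (κ₂ * Φ.collisionSum (Ioc s₁ (s₁ + w₂))
        (fun c => if c.fst = i then |‖c.postVel.1‖ ^ 2 - ‖c.preVel.1‖ ^ 2| / 2 else 0) z))
        ∂(localGibbsLaw σ a₀ u₀ θ₀ N Φ) ≤ ENNReal.ofReal 1)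
    {s s' : ℝ} (hs : s ∈ Icc 0 t) (hs' : s' ∈ Icc 0 t) (hss' : s ≤ s') (hsw₁ : s' ≤ s + w₁)
    (hsw₂ : s' ≤ s + w₂) :
    |(klDiv (Φ.lawAt (localGibbsLaw σ a₀ u₀ θ₀ N Φ) s')
          (localGibbsLaw σ (fun x => ρ s' x * Rf (σ ^ 3 * ρ s' x)) (u s') (θ s') N Φ)).toReal -
        (klDiv (Φ.lawAt (localGibbsLaw σ a₀ u₀ θ₀ N Φ) s)
          (localGibbsLaw σ (fun x => ρ s x * Rf (σ ^ 3 * ρ s x)) (u s) (θ s) N Φ)).toReal| ≤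
      (s' - s) * (((N : ℝ) + 1) * (K * (2 + max M 0 * C) + (m⁻¹ + LR * σ ^ 3) * Kρ * (3 + C) / 2 +
          (m⁻¹ + LR * σ ^ 3) * Kρ)) +
        4 * L * hsDiameter σ N * (((N : ℝ) + 1) * (κ₁⁻¹ * (V₁ + 1) + κ₂⁻¹ * (V₂ + 1))) := by
  have hσ2 : σ ≤ 1 / 2 := hσhalf.le
  haveI : IsProbabilityMeasure (localGibbsLaw σ a₀ u₀ θ₀ N Φ) :=
    isProbabilityMeasure_localGibbsLaw ha hθi hui ha0 hθi0 hσ2 N Φ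
  have hN : (0 : ℝ) < (N : ℝ) + 1 := by positivity
  have hgood := ae_mem_good_localGibbsLaw σ a₀ θ₀ u₀ N Φ
  have htT : Icc 0 t ⊆ Ico 0 T := Icc_subset_Ico_right ht.2
  have hh0 : 0 ≤ s' - s := sub_nonneg.2 hss'
  have hε0 : 0 ≤ hsDiameter σ N := (hsDiameter_pos hσ N).le
  -- slice facts on `[0, t]`
  have hρc : ∀ s₁ ∈ Icc 0 t, Continuous (ρ s₁) := fun s₁ h =>
    (hE.smooth_density.isSmooth_slice (htT h)).continuous
  have hθc : ∀ s₁ ∈ Icc 0 t, Continuous (θ s₁) := fun s₁ h =>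
    (hE.smooth_temperature.isSmooth_slice (htT h)).continuous
  have huc : ∀ s₁ ∈ Icc 0 t, Continuous (u s₁) := fun s₁ h =>
    (hE.smooth_velocity.isSmooth_slice (htT h)).continuous
  have hρ0 : ∀ s₁ ∈ Icc 0 t, ∀ x, 0 < ρ s₁ x := fun s₁ h => hE.density_pos s₁ (htT h)
  have hθ0 : ∀ s₁ ∈ Icc 0 t, ∀ x, 0 < θ s₁ x := fun s₁ h => hE.temperature_pos s₁ (htT h)
  have hmem : ∀ s₁ ∈ Icc 0 t, ∀ x, σ ^ 3 * ρ s₁ x ∈ Icc 0 r := fun s₁ h x =>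
    ⟨(mul_pos (pow_pos hσ 3) (hρ0 s₁ h x)).le, by rw [mul_comm]; exact (hpack s₁ h x).le⟩
  have hR1 : ∀ s₁ ∈ Icc 0 t, ∀ x, 1 ≤ Rf (σ ^ 3 * ρ s₁ x) := fun s₁ h x => (hRf _ (hmem s₁ h x)).1
  have hbc : ∀ s₁ ∈ Icc 0 t, Continuous fun x => ρ s₁ x * Rf (σ ^ 3 * ρ s₁ x) := fun s₁ h =>
    (hρc s₁ h).mul (hLR.continuousOn.comp_continuous (continuous_const.mul (hρc s₁ h)) (hmem s₁ h))
  have hb0 : ∀ s₁ ∈ Icc 0 t, ∀ x, 0 < ρ s₁ x * Rf (σ ^ 3 * ρ s₁ x) := fun s₁ h x =>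
    mul_pos (hρ0 s₁ h x) (zero_lt_one.trans_le (hR1 s₁ h x))
  -- the joint Lipschitz bound of `log b`
  set Cb : ℝ := (m⁻¹ + LR * σ ^ 3) * Kρ with hCb
  have hCb0 : 0 ≤ Cb := by positivity
  have hlogb : ∀ s₁ ∈ Icc 0 t, ∀ s₂ ∈ Icc 0 t, ∀ x x' : T3,
      |Real.log (ρ s₁ x * Rf (σ ^ 3 * ρ s₁ x)) - Real.log (ρ s₂ x' * Rf (σ ^ 3 * ρ s₂ x'))| ≤
        Cb * (|s₁ - s₂| + Torus.euclidDist x x') := by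
    intro s₁ h₁ s₂ h₂ x x'
    rw [Real.log_mul (hρ0 s₁ h₁ x).ne' (zero_lt_one.trans_le (hR1 s₁ h₁ x)).ne',
      Real.log_mul (hρ0 s₂ h₂ x').ne' (zero_lt_one.trans_le (hR1 s₂ h₂ x')).ne']
    have hρd : |ρ s₁ x - ρ s₂ x'| ≤ Kρ * (|s₁ - s₂| + Torus.euclidDist x x') := by
      have h := hKρ s₁ h₁ s₂ h₂ x x'
      rwa [Real.norm_eq_abs] at h
    have h1 : |Real.log (ρ s₁ x) - Real.log (ρ s₂ x')| ≤ m⁻¹ * |ρ s₁ x - ρ s₂ x'| :=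
      abs_log_sub_log_le hm0 (hm s₁ h₁ x) (hm s₂ h₂ x')
    have h2 : |Real.log (Rf (σ ^ 3 * ρ s₁ x)) - Real.log (Rf (σ ^ 3 * ρ s₂ x'))| ≤
        LR * σ ^ 3 * |ρ s₁ x - ρ s₂ x'| := by
      calc |Real.log (Rf (σ ^ 3 * ρ s₁ x)) - Real.log (Rf (σ ^ 3 * ρ s₂ x'))|
          ≤ 1⁻¹ * |Rf (σ ^ 3 * ρ s₁ x) - Rf (σ ^ 3 * ρ s₂ x')| :=
            abs_log_sub_log_le one_pos (hR1 s₁ h₁ x) (hR1 s₂ h₂ x')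
        _ = |Rf (σ ^ 3 * ρ s₁ x) - Rf (σ ^ 3 * ρ s₂ x')| := by rw [inv_one, one_mul]
        _ ≤ LR * |σ ^ 3 * ρ s₁ x - σ ^ 3 * ρ s₂ x'| := by
            have h := hLR.dist_le_mul _ (hmem s₁ h₁ x) _ (hmem s₂ h₂ x')
            rwa [Real.dist_eq, Real.dist_eq] at h
        _ = LR * σ ^ 3 * |ρ s₁ x - ρ s₂ x'| := by
            rw [← mul_sub, abs_mul, abs_of_pos (pow_pos hσ 3)]
            ring
    calc |Real.log (ρ s₁ x) + Real.log (Rf (σ ^ 3 * ρ s₁ x)) -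
          (Real.log (ρ s₂ x') + Real.log (Rf (σ ^ 3 * ρ s₂ x')))|
        = |(Real.log (ρ s₁ x) - Real.log (ρ s₂ x')) +
            (Real.log (Rf (σ ^ 3 * ρ s₁ x)) - Real.log (Rf (σ ^ 3 * ρ s₂ x')))| := by ring_nf
      _ ≤ |Real.log (ρ s₁ x) - Real.log (ρ s₂ x')| +
            |Real.log (Rf (σ ^ 3 * ρ s₁ x)) - Real.log (Rf (σ ^ 3 * ρ s₂ x'))| := abs_add_le _ _
      _ ≤ m⁻¹ * |ρ s₁ x - ρ s₂ x'| + LR * σ ^ 3 * |ρ s₁ x - ρ s₂ x'| := add_le_add h1 h2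
      _ = (m⁻¹ + LR * σ ^ 3) * |ρ s₁ x - ρ s₂ x'| := by ring
      _ ≤ (m⁻¹ + LR * σ ^ 3) * (Kρ * (|s₁ - s₂| + Torus.euclidDist x x')) :=
          mul_le_mul_of_nonneg_left hρd (by positivity)
      _ = Cb * (|s₁ - s₂| + Torus.euclidDist x x') := by rw [hCb]; ring
  -- §A the two explicit entropies and the integrable one-body sums
  have eS := toReal_klDiv_lawAt_eq_integral hσ2 ha hθi hui ha0 hθi0 (hbc s hs) (hθc s hs) (huc s hs)
    (hb0 s hs) (hθ0 s hs) N Φ s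
  have eS' := toReal_klDiv_lawAt_eq_integral hσ2 ha hθi hui ha0 hθi0 (hbc s' hs') (hθc s' hs') (huc s' hs')
    (hb0 s' hs') (hθ0 s' hs') N Φ s'
  have hG0 := integrable_oneBodySum hσ2 ha hθi hui ha0 hθi0 ha hθi hui ha0 hθi0 N Φ
  have hGs := integrable_oneBodySum_flow hσ2 ha hθi hui ha0 hθi0 (hbc s hs) (hθc s hs) (huc s hs)
    (hb0 s hs) (hθ0 s hs) N Φ s
  have hGs' := integrable_oneBodySum_flow hσ2 ha hθi hui ha0 hθi0 (hbc s' hs') (hθc s' hs') (huc s' hs')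
    (hb0 s' hs') (hθ0 s' hs') N Φ s'
  -- the log-partition increment
  have hZ : |Real.log (posPartition (fun x => ρ s' x * Rf (σ ^ 3 * ρ s' x)) (hsDiameter σ N) (N + 1)) -
      Real.log (posPartition (fun x => ρ s x * Rf (σ ^ 3 * ρ s x)) (hsDiameter σ N) (N + 1))| ≤
      ((N : ℝ) + 1) * (Cb * (s' - s)) := by
    refine abs_log_posPartition_sub_le (hbc s hs) (hbc s' hs') (hb0 s hs) (hb0 s' hs') (fun x => ?_) hσ2 N
    have h := hlogb s' hs' s hs x x
    rwa [Torus.euclidDist_self, add_zero, abs_of_nonneg hh0] at h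
  -- §B the pathwise bound on the transported one-body sums, on the good set
  obtain ⟨X, hX⟩ : ∃ X : Config (N + 1) (Fin 3) T3 → ℝ, ∀ z, X z =
      (∑ i, (Real.log (ρ s (Φ.flow s z i).1 * Rf (σ ^ 3 * ρ s (Φ.flow s z i).1)) -
          3 / 2 * Real.log (2 * Real.pi * θ s (Φ.flow s z i).1) -
          ‖(Φ.flow s z i).2 - u s (Φ.flow s z i).1‖ ^ 2 / (2 * θ s (Φ.flow s z i).1))) -
        ∑ i, (Real.log (ρ s' (Φ.flow s' z i).1 * Rf (σ ^ 3 * ρ s' (Φ.flow s' z i).1)) -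
          3 / 2 * Real.log (2 * Real.pi * θ s' (Φ.flow s' z i).1) -
          ‖(Φ.flow s' z i).2 - u s' (Φ.flow s' z i).1‖ ^ 2 / (2 * θ s' (Φ.flow s' z i).1)) :=
    ⟨_, fun z => rfl⟩
  obtain ⟨Y₁, hY₁⟩ : ∃ Y₁ : Config (N + 1) (Fin 3) T3 → ℝ, ∀ z, Y₁ z =
      ∫ r' in s..s', K * ∑ i, (1 + ‖(Φ.flow r' z i).2‖ ^ 3) := ⟨_, fun z => rfl⟩
  obtain ⟨Y₃, hY₃⟩ : ∃ Y₃ : Config (N + 1) (Fin 3) T3 → ℝ, ∀ z, Y₃ z =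
      Cb * (((N : ℝ) + 1) * (s' - s) + (s' - s) * ((((N : ℝ) + 1) + ∑ i, ‖(z i).2‖ ^ 2) / 2)) :=
    ⟨_, fun z => rfl⟩
  obtain ⟨Am, hAm⟩ : ∃ Am : Config (N + 1) (Fin 3) T3 → ℝ, ∀ z, Am z =
      ∑ i, Φ.collisionSum (Ioc s s') (fun c => if c.fst = i then ‖c.postVel.1 - c.preVel.1‖ else 0) z :=
    ⟨_, fun z => rfl⟩
  obtain ⟨Ae, hAe⟩ : ∃ Ae : Config (N + 1) (Fin 3) T3 → ℝ, ∀ z, Ae z =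
      ∑ i, Φ.collisionSum (Ioc s s')
        (fun c => if c.fst = i then |‖c.postVel.1‖ ^ 2 - ‖c.preVel.1‖ ^ 2| / 2 else 0) z :=
    ⟨_, fun z => rfl⟩
  have hsplit : ∀ (s₁ : ℝ) (y : Config (N + 1) (Fin 3) T3),
      ∑ i, (Real.log (ρ s₁ (y i).1 * Rf (σ ^ 3 * ρ s₁ (y i).1)) -
        3 / 2 * Real.log (2 * Real.pi * θ s₁ (y i).1) - ‖(y i).2 - u s₁ (y i).1‖ ^ 2 / (2 * θ s₁ (y i).1)) =
      (∑ i, Real.log (ρ s₁ (y i).1 * Rf (σ ^ 3 * ρ s₁ (y i).1))) + gSum (fun _ _ => (1 : ℝ)) θ u s₁ y := by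
    intro s₁ y
    simp only [gSum, gExp, Real.log_one, ← Finset.sum_add_distrib]
    exact Finset.sum_congr rfl fun i _ => by ring
  have hc0 : 0 ≤ 4 * L * hsDiameter σ N := by positivity
  have hpt : ∀ᵐ z ∂(localGibbsLaw σ a₀ u₀ θ₀ N Φ), |X z| ≤ Y₁ z + Y₃ z +
      4 * L * hsDiameter σ N * Am z + 4 * L * hsDiameter σ N * Ae z := by
    filter_upwards [hgood] with z hz
    rw [hX, hY₁, hY₃, hAm, hAe]
    -- the pathwise balance of the unit-activity exponent over `[s, s']`
    have hbal := gSum_sub_eq Φ (a := fun _ _ => (1 : ℝ))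
      (Torus.isSmoothSpaceTimeOn_const (Torus.isSmooth_const (1 : ℝ)) _) hE.smooth_temperature
      hE.smooth_velocity (fun _ _ _ => one_pos) hE.temperature_pos hz (h := s' - s) hs.1 hh0
      (by linarith [hs'.2, ht.2])
    rw [add_sub_cancel] at hbal
    have hstream := abs_integral_DgSum_le Φ hK hz hs.1 hss' hs'.2
    have hcoll := abs_collisionSum_pairKernel_le hσ hσhalf Φ hL0 hβ hγ hz hs.1 hs'.2 (s := s)
    rw [sum_collisionSum_transfer_eq Φ hz s s', mul_add] at hcoll
    have hdisp := sum_euclidDist_flow_le Φ hz hss'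
    have hact : |∑ i, (Real.log (ρ s (Φ.flow s z i).1 * Rf (σ ^ 3 * ρ s (Φ.flow s z i).1)) -
        Real.log (ρ s' (Φ.flow s' z i).1 * Rf (σ ^ 3 * ρ s' (Φ.flow s' z i).1)))| ≤
        Cb * (((N : ℝ) + 1) * (s' - s) + (s' - s) * ((((N : ℝ) + 1) + ∑ i, ‖(z i).2‖ ^ 2) / 2)) := by
      refine (Finset.abs_sum_le_sum_abs _ _).trans ?_
      calc ∑ i, |Real.log (ρ s (Φ.flow s z i).1 * Rf (σ ^ 3 * ρ s (Φ.flow s z i).1)) -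
            Real.log (ρ s' (Φ.flow s' z i).1 * Rf (σ ^ 3 * ρ s' (Φ.flow s' z i).1))|
          ≤ ∑ i, Cb * (|s - s'| + Torus.euclidDist (Φ.flow s z i).1 (Φ.flow s' z i).1) :=
            Finset.sum_le_sum fun i _ => hlogb s hs s' hs' _ _
        _ = Cb * (((N : ℝ) + 1) * (s' - s) + ∑ i, Torus.euclidDist (Φ.flow s z i).1 (Φ.flow s' z i).1) := by
            rw [← Finset.mul_sum, Finset.sum_add_distrib, Finset.sum_const, Finset.card_univ, Fintype.card_fin,
              nsmul_eq_mul, abs_sub_comm, abs_of_nonneg hh0]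
            push_cast
            ring
        _ ≤ Cb * (((N : ℝ) + 1) * (s' - s) + (s' - s) * ((((N : ℝ) + 1) + ∑ i, ‖(z i).2‖ ^ 2) / 2)) :=
            mul_le_mul_of_nonneg_left (add_le_add le_rfl hdisp) hCb0
    rw [hsplit s, hsplit s']
    have halg : ∀ (A G A' G' : ℝ), A + G - (A' + G') = -(G' - G) + (A - A') := fun _ _ _ _ => by ring
    rw [halg, hbal, ← Finset.sum_sub_distrib]
    refine (abs_add_le _ _).trans ?_
    rw [abs_neg]
    have h3 := (abs_add_le _ _).trans (add_le_add hstream hcoll)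
    linarith [h3, hact]
  -- §C in mean
  have hY₁0 : ∀ z, 0 ≤ Y₁ z := fun z => by
    rw [hY₁]
    exact intervalIntegral.integral_nonneg hss' fun r' _ =>
      mul_nonneg hK0 (Finset.sum_nonneg fun i _ => by positivity)
  have hY₃0 : ∀ z, 0 ≤ Y₃ z := fun z => by rw [hY₃]; positivity
  have hA0 : ∀ (g : HardSphereCollisionRecord (Fin 3) T3 (N + 1) → ℝ), (∀ c, 0 ≤ g c) →
      ∀ z, 0 ≤ ∑ i, Φ.collisionSum (Ioc s s') (fun c => if c.fst = i then g c else 0) z := fun g hg z =>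
    Finset.sum_nonneg fun i _ => collisionSum_nonneg' Φ (fun c => by
      split_ifs
      · exact hg c
      · exact le_rfl) _ z
  have hAm0 : ∀ z, 0 ≤ Am z := fun z => by rw [hAm]; exact hA0 _ (fun c => norm_nonneg _) z
  have hAe0 : ∀ z, 0 ≤ Ae z := fun z => by rw [hAe]; exact hA0 _ (fun c => by positivity) z
  -- measurability of the three measurable bounds
  have hf₁ : AEMeasurable (fun z => ENNReal.ofReal (Y₁ z)) (localGibbsLaw σ a₀ u₀ θ₀ N Φ) := by
    simp only [hY₁]
    exact aemeasurable_streamingBound Φ hK0 hss'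
  have hf₃ : AEMeasurable (fun z => ENNReal.ofReal (Y₃ z)) (localGibbsLaw σ a₀ u₀ θ₀ N Φ) := by
    simp only [hY₃]
    have h : Measurable fun z : Config (N + 1) (Fin 3) T3 => ∑ i, ‖(z i).2‖ ^ 2 := by fun_prop
    exact (measurable_const.mul (measurable_const.add (measurable_const.mul
      ((measurable_const.add h).div_const 2)))).ennreal_ofReal.aemeasurable
  have hfm : AEMeasurable (fun z => ENNReal.ofReal (4 * L * hsDiameter σ N * Am z))
      (localGibbsLaw σ a₀ u₀ θ₀ N Φ) := by
    simp only [hAm]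
    exact ((Finset.aemeasurable_fun_sum _ fun i _ =>
      aemeasurable_momActivity hσ hσhalf Φ i s s' hgood).const_mul _).ennreal_ofReal
  -- the four expectations
  have hE₁ : ∫⁻ z, ENNReal.ofReal (Y₁ z) ∂(localGibbsLaw σ a₀ u₀ θ₀ N Φ) ≤
      ENNReal.ofReal ((s' - s) * (K * ((N : ℝ) + 1) * (2 + max M 0 * C))) := by
    simp only [hY₁]
    exact lintegral_streamingBound_le hσ2 ha hθi hui ha0 hθi0 Φ hK0 hC0 hs.1 hss' hs'.2 hKE hECT
  have ha3 : 0 ≤ Cb * (s' - s) * ((N : ℝ) + 1) * (3 / 2) := by positivity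
  have hb3 : 0 ≤ Cb * (s' - s) * ((N : ℝ) + 1) / 2 := by positivity
  have hE₃ : ∫⁻ z, ENNReal.ofReal (Y₃ z) ∂(localGibbsLaw σ a₀ u₀ θ₀ N Φ) ≤
      ENNReal.ofReal (Cb * (s' - s) * ((N : ℝ) + 1) * (3 + C) / 2) := by
    have hmeas : Measurable fun z : Config (N + 1) (Fin 3) T3 =>
        ENNReal.ofReal (((N : ℝ) + 1)⁻¹ * ∑ i, ‖(z i).2‖ ^ 2) := by
      refine Measurable.ennreal_ofReal ?_
      fun_prop
    have hpt₃ : ∀ z, ENNReal.ofReal (Y₃ z) = ENNReal.ofReal (Cb * (s' - s) * ((N : ℝ) + 1) * (3 / 2)) +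
        ENNReal.ofReal (Cb * (s' - s) * ((N : ℝ) + 1) / 2) *
          ENNReal.ofReal (((N : ℝ) + 1)⁻¹ * ∑ i, ‖(z i).2‖ ^ 2) := by
      intro z
      have he0 : 0 ≤ ((N : ℝ) + 1)⁻¹ * ∑ i, ‖(z i).2‖ ^ 2 := by positivity
      rw [← ENNReal.ofReal_mul hb3, ← ENNReal.ofReal_add ha3 (mul_nonneg hb3 he0), hY₃]
      congr 1
      field_simp
      ring
    calc ∫⁻ z, ENNReal.ofReal (Y₃ z) ∂(localGibbsLaw σ a₀ u₀ θ₀ N Φ)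
        = ∫⁻ z, (ENNReal.ofReal (Cb * (s' - s) * ((N : ℝ) + 1) * (3 / 2)) +
            ENNReal.ofReal (Cb * (s' - s) * ((N : ℝ) + 1) / 2) *
              ENNReal.ofReal (((N : ℝ) + 1)⁻¹ * ∑ i, ‖(z i).2‖ ^ 2)) ∂(localGibbsLaw σ a₀ u₀ θ₀ N Φ) :=
          lintegral_congr hpt₃
      _ = ENNReal.ofReal (Cb * (s' - s) * ((N : ℝ) + 1) * (3 / 2)) +
            ENNReal.ofReal (Cb * (s' - s) * ((N : ℝ) + 1) / 2) *
              ∫⁻ z, ENNReal.ofReal (((N : ℝ) + 1)⁻¹ * ∑ i, ‖(z i).2‖ ^ 2) ∂(localGibbsLaw σ a₀ u₀ θ₀ N Φ) := by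
          rw [lintegral_add_left measurable_const, lintegral_const, measure_univ, mul_one,
            lintegral_const_mul _ hmeas]
      _ ≤ ENNReal.ofReal (Cb * (s' - s) * ((N : ℝ) + 1) * (3 / 2)) +
            ENNReal.ofReal (Cb * (s' - s) * ((N : ℝ) + 1) / 2) * ENNReal.ofReal C := by gcongr
      _ = ENNReal.ofReal (Cb * (s' - s) * ((N : ℝ) + 1) * (3 + C) / 2) := by
          rw [← ENNReal.ofReal_mul hb3, ← ENNReal.ofReal_add ha3 (mul_nonneg hb3 hC0)]
          congr 1
          ring
  have hEm : ∫⁻ z, ENNReal.ofReal (4 * L * hsDiameter σ N * Am z) ∂(localGibbsLaw σ a₀ u₀ θ₀ N Φ) ≤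
      ENNReal.ofReal (4 * L * hsDiameter σ N) * ENNReal.ofReal (κ₁⁻¹ * (((N : ℝ) + 1) * (V₁ + 1))) := by
    have h := lintegral_sum_collisionSum_le_of_tail Φ hgood (g := fun c => ‖c.postVel.1 - c.preVel.1‖)
      (fun c => norm_nonneg _) hss' hsw₁ hκ₁ hV₁ (hCATb s hs)
    calc ∫⁻ z, ENNReal.ofReal (4 * L * hsDiameter σ N * Am z) ∂(localGibbsLaw σ a₀ u₀ θ₀ N Φ)
        = ENNReal.ofReal (4 * L * hsDiameter σ N) *
            ∫⁻ z, ENNReal.ofReal (Am z) ∂(localGibbsLaw σ a₀ u₀ θ₀ N Φ) := by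
          rw [← lintegral_const_mul' _ _ ENNReal.ofReal_ne_top]
          exact lintegral_congr fun z => ENNReal.ofReal_mul hc0
      _ ≤ ENNReal.ofReal (4 * L * hsDiameter σ N) * ENNReal.ofReal (κ₁⁻¹ * (((N : ℝ) + 1) * (V₁ + 1))) := by
          simp only [hAm]
          gcongr
  have hEe : ∫⁻ z, ENNReal.ofReal (4 * L * hsDiameter σ N * Ae z) ∂(localGibbsLaw σ a₀ u₀ θ₀ N Φ) ≤
      ENNReal.ofReal (4 * L * hsDiameter σ N) * ENNReal.ofReal (κ₂⁻¹ * (((N : ℝ) + 1) * (V₂ + 1))) := by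
    have h := lintegral_sum_collisionSum_le_of_tail Φ hgood
      (g := fun c => |‖c.postVel.1‖ ^ 2 - ‖c.preVel.1‖ ^ 2| / 2)
      (fun c => by positivity) hss' hsw₂ hκ₂ hV₂ (hCEATb s hs)
    calc ∫⁻ z, ENNReal.ofReal (4 * L * hsDiameter σ N * Ae z) ∂(localGibbsLaw σ a₀ u₀ θ₀ N Φ)
        = ENNReal.ofReal (4 * L * hsDiameter σ N) *
            ∫⁻ z, ENNReal.ofReal (Ae z) ∂(localGibbsLaw σ a₀ u₀ θ₀ N Φ) := by
          rw [← lintegral_const_mul' _ _ ENNReal.ofReal_ne_top]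
          exact lintegral_congr fun z => ENNReal.ofReal_mul hc0
      _ ≤ ENNReal.ofReal (4 * L * hsDiameter σ N) * ENNReal.ofReal (κ₂⁻¹ * (((N : ℝ) + 1) * (V₂ + 1))) := by
          simp only [hAe]
          gcongr
  -- assembling the mean bound
  set B₁ : ℝ := (s' - s) * (K * ((N : ℝ) + 1) * (2 + max M 0 * C)) + Cb * (s' - s) * ((N : ℝ) + 1) * (3 + C) / 2 +
    4 * L * hsDiameter σ N * (κ₁⁻¹ * (((N : ℝ) + 1) * (V₁ + 1))) +
    4 * L * hsDiameter σ N * (κ₂⁻¹ * (((N : ℝ) + 1) * (V₂ + 1))) with hB₁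
  have hT1 : 0 ≤ (s' - s) * (K * ((N : ℝ) + 1) * (2 + max M 0 * C)) := by positivity
  have hT3 : 0 ≤ Cb * (s' - s) * ((N : ℝ) + 1) * (3 + C) / 2 := by positivity
  have hTm : 0 ≤ κ₁⁻¹ * (((N : ℝ) + 1) * (V₁ + 1)) := by positivity
  have hTe : 0 ≤ κ₂⁻¹ * (((N : ℝ) + 1) * (V₂ + 1)) := by positivity
  have hB₁0 : 0 ≤ B₁ := by positivity
  have hmean : ∫⁻ z, ENNReal.ofReal (|X z|) ∂(localGibbsLaw σ a₀ u₀ θ₀ N Φ) ≤ ENNReal.ofReal B₁ := by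
    calc ∫⁻ z, ENNReal.ofReal (|X z|) ∂(localGibbsLaw σ a₀ u₀ θ₀ N Φ)
        ≤ ∫⁻ z, (ENNReal.ofReal (Y₁ z) + ENNReal.ofReal (Y₃ z) + ENNReal.ofReal (4 * L * hsDiameter σ N * Am z) +
            ENNReal.ofReal (4 * L * hsDiameter σ N * Ae z)) ∂(localGibbsLaw σ a₀ u₀ θ₀ N Φ) := by
          refine lintegral_mono_ae (hpt.mono fun z hz => ?_)
          rw [← ENNReal.ofReal_add (hY₁0 z) (hY₃0 z),
            ← ENNReal.ofReal_add (add_nonneg (hY₁0 z) (hY₃0 z)) (mul_nonneg hc0 (hAm0 z)),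
            ← ENNReal.ofReal_add (add_nonneg (add_nonneg (hY₁0 z) (hY₃0 z)) (mul_nonneg hc0 (hAm0 z)))
              (mul_nonneg hc0 (hAe0 z))]
          exact ENNReal.ofReal_le_ofReal hz
      _ = ∫⁻ z, ENNReal.ofReal (Y₁ z) ∂(localGibbsLaw σ a₀ u₀ θ₀ N Φ) +
            ∫⁻ z, ENNReal.ofReal (Y₃ z) ∂(localGibbsLaw σ a₀ u₀ θ₀ N Φ) +
            ∫⁻ z, ENNReal.ofReal (4 * L * hsDiameter σ N * Am z) ∂(localGibbsLaw σ a₀ u₀ θ₀ N Φ) +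
            ∫⁻ z, ENNReal.ofReal (4 * L * hsDiameter σ N * Ae z) ∂(localGibbsLaw σ a₀ u₀ θ₀ N Φ) := by
          have m12 : AEMeasurable (fun z => ENNReal.ofReal (Y₁ z) + ENNReal.ofReal (Y₃ z))
              (localGibbsLaw σ a₀ u₀ θ₀ N Φ) := hf₁.add hf₃
          have m123 : AEMeasurable (fun z => ENNReal.ofReal (Y₁ z) + ENNReal.ofReal (Y₃ z) +
              ENNReal.ofReal (4 * L * hsDiameter σ N * Am z)) (localGibbsLaw σ a₀ u₀ θ₀ N Φ) := m12.add hfm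
          rw [lintegral_add_left' m123, lintegral_add_left' m12, lintegral_add_left' hf₁]
      _ ≤ ENNReal.ofReal ((s' - s) * (K * ((N : ℝ) + 1) * (2 + max M 0 * C))) +
            ENNReal.ofReal (Cb * (s' - s) * ((N : ℝ) + 1) * (3 + C) / 2) +
            ENNReal.ofReal (4 * L * hsDiameter σ N) * ENNReal.ofReal (κ₁⁻¹ * (((N : ℝ) + 1) * (V₁ + 1))) +
            ENNReal.ofReal (4 * L * hsDiameter σ N) * ENNReal.ofReal (κ₂⁻¹ * (((N : ℝ) + 1) * (V₂ + 1))) :=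
          add_le_add (add_le_add (add_le_add hE₁ hE₃) hEm) hEe
      _ = ENNReal.ofReal B₁ := by
          rw [← ENNReal.ofReal_mul hc0, ← ENNReal.ofReal_mul hc0, ← ENNReal.ofReal_add hT1 hT3,
            ← ENNReal.ofReal_add (add_nonneg hT1 hT3) (mul_nonneg hc0 hTm),
            ← ENNReal.ofReal_add (add_nonneg (add_nonneg hT1 hT3) (mul_nonneg hc0 hTm)) (mul_nonneg hc0 hTe)]
  have hint : |∫ z, X z ∂(localGibbsLaw σ a₀ u₀ θ₀ N Φ)| ≤ B₁ := by
    have h := norm_integral_le_lintegral_norm (μ := localGibbsLaw σ a₀ u₀ θ₀ N Φ) X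
    rw [Real.norm_eq_abs] at h
    refine h.trans (ENNReal.toReal_le_of_le_ofReal hB₁0 ?_)
    simpa only [Real.norm_eq_abs] using hmean
  -- §D conclusion
  rw [eS', eS, integral_sub hG0 hGs', integral_sub hG0 hGs]
  rw [show ∀ A B B' c c' d : ℝ, (A - B' + (c' - d)) - (A - B + (c - d)) = (B - B') + (c' - c) from
    fun _ _ _ _ _ _ => by ring, ← integral_sub hGs hGs']
  refine (abs_add_le _ _).trans ?_
  simp only [hX] at hint
  refine (add_le_add hint hZ).trans (le_of_eq ?_)
  rw [hB₁, hCb]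
  ring

end Summit.AtomisticToContinuum.HydrodynamicLimit.Theorems.HydroLimitInBandContinuity

end
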